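import Literature.AlgebraicGeometry.Frobenioids.Categories
import Mathlib.CategoryTheory.Comma.Over.Basic
import HarnessLib

/-!
# Frobenioids I, §0 / proof of Theorem 3.4 (v): in a SLIM category, `D_X → D_Y` determines the arrow `X → Y`

Mochizuki, *The geometry of Frobenioids I: the general theory*, Kyushu J. Math. **62** (2008)
293–400, §0 ("slim", p. 15) and the proof of Thm. 3.4 (v), p. 67 l. 40 – p. 68 l. 14
[cite: MochizukiFrdI2008, Thm. 3.4 (v) p.68]:

> "… since the category `D_i`, hence also the categories `(D_i)_{A_D}`, `(P_i)_A`, are slim, it follows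
> that the collection of categories `(P_i)_A` … and functors `(P_i)_{A'} → (P_i)_A` … determine a 2-slim
> 2-category of 1-categories, whose coarsification we denote by `Q_i` … the natural functor `D_i → E_i`
> … may be identified with the slim exponentiation functor of Proposition A.2, hence, in particular, is
> an equivalence of categories."

PROOF-ONLY file (seat abc-iut-L1-d4 gen 2; first brick of sub-node FrdI:Thm3.4(v)/L12 of
plan/L1/SUBDAG-FrdI-Thm34.md). The one categorical fact about slimness that the reconstruction of the
arrows of `D_i` from the slice categories uses — the FAITHFULNESS half of "`D → E` is an equivalence":
if `D` is slim and the functors `D_X → D_Y` induced by `f, g : X → Y` are isomorphic, then `f = g`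
(whiskering the isomorphism with `D_Y → D` gives an automorphism of `D_X → D`, trivial by slimness; read
off the component at `(X, id)`). Consequence used for Thm. 3.4 (v): base-equivalence of two arrows of a
Frobenioid over a slim base is detected by the induced functors on pull-back slices. Mathlib only
(`Over.map`, `Over.mapForget`) over abc-iut-found's `IsSlim`. Nothing of [FrdI] is restated.
-/

namespace Literature.AlgebraicGeometry.Frobenioids

open CategoryTheory

universe v u

variable {D : Type u} [Category.{v} D]

/-- **Slimness detects arrows through slices**: in a slim category, if `Over.map f ≅ Over.map g` for
`f, g : X → Y`, then `f = g`. [cite: MochizukiFrdI2008, Thm. 3.4 (v) p.68] -/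
theorem IsSlim.eq_of_over_map_iso (h : IsSlim D) {X Y : D} {f g : X ⟶ Y} (θ : Over.map f ≅ Over.map g) :
    f = g := by
  -- the induced automorphism of `D_X → D` (underlying arrows of the components of `θ`)
  let α : Over.forget X ≅ Over.forget X :=
    NatIso.ofComponents (fun U => (Over.forget Y).mapIso (θ.app U)) (fun {U V} k => by
      have := congrArg CommaMorphism.left (θ.hom.naturality k)
      simp only [Over.comp_left, Over.map_map_left] at this
      exact this)
  have hα : α = Iso.refl _ := h.isRigid_forget X α
  -- its component at `(X, id)` is the underlying arrow of `θ_{(X, id)}`, hence the identity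
  have hU : (θ.hom.app (Over.mk (𝟙 X))).left = 𝟙 X :=
    congrArg (fun β : Over.forget X ≅ Over.forget X => β.hom.app (Over.mk (𝟙 X))) hα
  -- `θ_{(X, id)} : (X, f) → (X, g)` is a morphism over `Y`
  have hw := Over.w (θ.hom.app (Over.mk (𝟙 X)))
  simp only [Over.map_obj_hom, Over.mk_hom, hU] at hw
  have hw' : 𝟙 X ≫ f = 𝟙 X ≫ 𝟙 X ≫ g := hw.symm
  simpa using hw'

/-- The same with the isomorphism taken up to the forgetful functors' identification: an isomorphism of
the composite functors `D_X → D_Y` for `f` and `g` after any auto-equivalence is not needed — recorded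
as the `Nonempty` form for use with existence statements. [cite: MochizukiFrdI2008, Thm. 3.4 (v) p.68] -/
theorem IsSlim.eq_of_nonempty_over_map_iso (h : IsSlim D) {X Y : D} {f g : X ⟶ Y}
    (hθ : Nonempty (Over.map f ≅ Over.map g)) : f = g := by
  obtain ⟨θ⟩ := hθ
  exact h.eq_of_over_map_iso θ

end Literature.AlgebraicGeometry.Frobenioids
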